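import Summits.NavierStokesRegularity.FluidComputer.BandFluxCeiling
import Summits.NavierStokesRegularity.FluidComputer.FrontResidenceCost
import HarnessLib

/-!
# Fluid computer — L18: the TAIL ENSTROPHY-TIME floor and ceiling, and the TAIL DISSIPATION floor of a blow-up

HONEST FRAMING (cell `pub-fluidc`, verbatim): *low prior, high value-of-information experiment on Tao's
machine paradigm; NOT a claim that NS blows up.* Theorem side of the cell (necessities / ceilings every cascade
design must respect); nothing here is evidence of blow-up, and nothing is said about any fixed finite set of levels.

The spectral TAIL beyond the scale `2^q` of a maximal smooth Leray–Hopf solution on a terminal window `(t₀, T)` carries the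
enstrophy-time `Tail_q := ∑_{p ≥ q} 4^p ∫_{t₀}^{T} ‖Δ̇_p u(τ)‖₂² dτ` and the dissipation `ν ∑_{p ≥ q} ∫_{t₀}^{T} S_p(u(τ)) dτ`
(`S_p = ∑_i ‖∂_i Δ̇_p u‖₂²`) — where DNS reads "how much dissipation sits beyond wavenumber `k`" (resolution flags
`k_max η_K`, dissipation spectra). This module names the floor hidden inside L16′'s proof and the matching ceiling:

* `tail_enstrophyTime_floor` (**L18 — THE TAIL ENSTROPHY-TIME FLOOR**) — there is an absolute `κ₁ > 0` with: for every
  maximal smooth Leray–Hopf solution and every `t₀ ∈ [0, T)`, at INFINITELY MANY levels `q`,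
  `κ₁ ν² < 2^{3q/2} ‖u(0)‖₂ · Tail_q` — the enstrophy-time carried at or above level `q` in the window is at least
  `κ₁ ν² 2^{-3q/2}/‖u₀‖₂` (L15′ `FrontResidenceCost.amplitude_tail_floor` × the energy-class bound on the window sup
  `LevelFluxFloor.exists_iSup_blockSup_le_energy`).
* `tail_enstrophyTime_le` (**THE TAIL ENSTROPHY-TIME CEILING**) — for EVERY `q` and every `t₀ ∈ [0, T)`,
  `ν · Tail_q ≤ 12 C_r² ‖u(0)‖₂²` (Tonelli, `F ≤ 24 C_r² ∑_i ‖∂_i u‖₂²`, the energy inequality with the classical gradient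
  `BandFluxCeiling.dissipation_le_energy`).
* `tail_dissipation_floor` (**L18′ — THE TAIL DISSIPATION FLOOR**) — there is an absolute `κ₂ > 0` with: at infinitely many
  levels `q`, `κ₂ ν³ < 2^{3q/2} ‖u(0)‖₂ · ν ∑_{p ≥ q} ∫_{t₀}^{T} S_p(u) dτ` — a realised blow-up DISSIPATES at least
  `κ₂ ν³ 2^{-3q/2}/‖u₀‖₂` at or beyond every sufficiently high scale `2^q` (along a subsequence of levels) in every terminal
  window (reverse Bernstein `4^p ‖Δ̇_p u‖₂² ≤ 3 C_r² S_p`); against the ceiling `ν ∫∫|∇u|² ≤ ½‖u₀‖₂²` the SHARE of the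
  window's dissipation sitting beyond `2^q` is at least `2κ₂ (ν/‖u₀‖₂)³ 2^{-3q/2}`, infinitely often.
  HONEST SIZE NOTE: the factor `(ν/‖u₀‖₂)³` is `≈ 3·10⁻⁷` on the cell's rows at `ρ = 3` — these floors constrain the
  asymptotics `q → ∞` of a would-be blow-up, not the measured levels one and two. Necessity only; nothing about sufficiency.

0 sorry; no new definitions, no named facts (inputs: `FrontResidenceCost.amplitude_tail_floor`,
`LevelFluxFloor.exists_iSup_blockSup_le_energy`, `BandFluxCeiling.dissipation_le_energy` /
`sum_eLpNorm_fderiv_sq_eq_lintegral`, `BlockViscousRent.four_pow_mul_blockL2_sq_le`, `LPBounds.dyadicF_le_gradSq`).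

## References

* A. Cheskidov, R. Shvydkoy, J. Math. Fluid Mech. 16 (2014) 263–273 = arXiv:1102.1944, Lemma 4.1 (the a-priori tail of a
  Leray–Hopf solution). [CheskidovShvydkoy2011]
* A. Cheskidov, M. Dai, arXiv:1507.06611 = Proc. Edinburgh Math. Soc. (2025), Thm. 1.1. [CheskidovDai2015]
-/

noncomputable section

open MeasureTheory Set Function Filter Topology
open scoped ENNReal NNReal RealInnerProductSpace
open Literature.Analysis.FluidPDE Literature.Analysis.FunctionSpaces
open Literature.Analysis.FluidPDE.LPBounds (gradSq)
open Summit.NavierStokesRegularity.FluidComputer.BlockEnergyTransport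
open Summit.NavierStokesRegularity.FluidComputer.BlockEnergyIdentity
open Summit.NavierStokesRegularity.FluidComputer.LevelFluxFloor
open Summit.NavierStokesRegularity.FluidComputer.BandFluxCeiling

namespace Summit.NavierStokesRegularity.FluidComputer.TailDissipationFloor

/-! ## L18 — the tail enstrophy-time floor -/

/-- **L18 — THE TAIL ENSTROPHY-TIME FLOOR.** There is an absolute `κ₁ > 0` such that for every `ν > 0`, `T > 0`, every
maximal smooth solution `(u, p)` of the unforced Navier–Stokes system on `ℝ³ × [0, T)` which is Leray–Hopf from `u 0`, and
every `t₀ ∈ [0, T)`: at INFINITELY MANY levels `q`,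
`κ₁ ν² < 2^{3q/2} · ‖u(0)‖₂ · ∑_{n ≥ 0} 4^{q+n} ∫⁻_{(t₀,T)} ‖Δ̇_{q+n} u(τ)‖₂² dτ` — the spectral tail at or above level `q`
carries enstrophy-time at least `κ₁ ν² 2^{-3q/2}/‖u₀‖₂` in every terminal window. Proof: L15′
(`c³ν² < C_B² U_q Tail_q` i.o.) and `U_q = sup_{(t₀,T)} ‖Δ̇_q u‖_∞ ≤ C₁ 2^{3q/2} ‖u(0)‖₂`; the degenerate constant
`C₁ = 0` is absorbed by `C₁ + 1`. [cite: CheskidovDai2015, §1 Thm. 1.1] -/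
theorem tail_enstrophyTime_floor :
    ∃ κ₁ : ℝ, 0 < κ₁ ∧ ∀ (ν T : ℝ), 0 < ν → 0 < T →
      ∀ (u : ℝ → EuclideanSpace ℝ (Fin 3) → EuclideanSpace ℝ (Fin 3)) (p : ℝ → EuclideanSpace ℝ (Fin 3) → ℝ),
      IsMaximalSmoothSolution ν 0 u p T → IsLerayHopfOn T ν 0 (u 0) u →
      ∀ t₀ ∈ Ico 0 T, ∃ᶠ q : ℕ in atTop,
        ENNReal.ofReal (κ₁ * ν ^ 2) <
          (2 : ℝ≥0∞) ^ ((q : ℝ) * (3 / 2)) * eLpNorm (u 0) 2 volume *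
            ∑' n : ℕ, (2 : ℝ≥0∞) ^ (2 * (q + n)) * ∫⁻ τ in Ioo t₀ T, blockL2 (u τ) (q + n : ℕ) ^ 2 := by
  obtain ⟨c, CB, hc, hCB, Hat⟩ := FrontResidenceCost.amplitude_tail_floor
  obtain ⟨C₁, hC₁⟩ := exists_iSup_blockSup_le_energy
  have hcbpos : 0 < (CB : ℝ) := NNReal.coe_pos.2 (pos_iff_ne_zero.2 hCB)
  set κ₁ : ℝ := c ^ 3 / ((CB : ℝ) ^ 2 * ((C₁ : ℝ) + 1)) with hκ₁
  have hκ₁pos : 0 < κ₁ := by positivity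
  refine ⟨κ₁, hκ₁pos, fun ν T hν hT u p hmax hLH t₀ ht₀ => ?_⟩
  -- the constant `D = C_B² (C₁ + 1)` in `ℝ≥0∞`, positive and finite
  set D : ℝ≥0∞ := (CB : ℝ≥0∞) ^ 2 * ((C₁ : ℝ≥0∞) + 1) with hD
  have hD0 : D ≠ 0 := mul_ne_zero (pow_ne_zero _ (ENNReal.coe_ne_zero.2 hCB)) (by simp)
  have hDtop : D ≠ ∞ := ENNReal.mul_ne_top (ENNReal.pow_ne_top ENNReal.coe_ne_top)
    (ENNReal.add_ne_top.2 ⟨ENNReal.coe_ne_top, ENNReal.one_ne_top⟩)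
  have hDreal : D = ENNReal.ofReal ((CB : ℝ) ^ 2 * ((C₁ : ℝ) + 1)) := by
    rw [hD, ENNReal.ofReal_mul (by positivity), ENNReal.ofReal_pow hcbpos.le, ENNReal.ofReal_coe_nnreal,
      ENNReal.ofReal_add (NNReal.coe_nonneg C₁) zero_le_one, ENNReal.ofReal_coe_nnreal, ENNReal.ofReal_one]
  have hkey : ENNReal.ofReal (κ₁ * ν ^ 2) * D = ENNReal.ofReal (c ^ 3 * ν ^ 2) := by
    rw [hDreal, ← ENNReal.ofReal_mul (by positivity)]
    congr 1
    rw [hκ₁]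
    field_simp
  refine (Hat ν T hν hT u p hmax hLH t₀ ht₀).mono fun q hq => ?_
  set Tail : ℝ≥0∞ := ∑' n : ℕ, (2 : ℝ≥0∞) ^ (2 * (q + n)) *
    ∫⁻ τ in Ioo t₀ T, blockL2 (u τ) (q + n : ℕ) ^ 2 with hTail
  set Y : ℝ≥0∞ := (2 : ℝ≥0∞) ^ ((q : ℝ) * (3 / 2)) * eLpNorm (u 0) 2 volume * Tail with hY
  have hU := hC₁ ν T hν.le u hLH t₀ ht₀.1 q
  have hκD : ENNReal.ofReal (κ₁ * ν ^ 2) = ENNReal.ofReal (c ^ 3 * ν ^ 2) / D := by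
    rw [ENNReal.eq_div_iff hD0 hDtop, mul_comm D]
    exact hkey
  rw [hκD, ENNReal.div_lt_iff (Or.inl hD0) (Or.inl hDtop)]
  refine hq.trans_le ?_
  calc (CB : ℝ≥0∞) ^ 2 * (⨆ τ ∈ Ioo t₀ T, blockSup (u τ) q) * Tail
        ≤ (CB : ℝ≥0∞) ^ 2 * ((C₁ : ℝ≥0∞) * (2 : ℝ≥0∞) ^ ((q : ℝ) * (3 / 2)) * eLpNorm (u 0) 2 volume) * Tail := by
          gcongr
      _ ≤ (CB : ℝ≥0∞) ^ 2 * (((C₁ : ℝ≥0∞) + 1) * (2 : ℝ≥0∞) ^ ((q : ℝ) * (3 / 2)) * eLpNorm (u 0) 2 volume) *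
            Tail := by
          gcongr
          exact le_self_add
      _ = Y * D := by rw [hY, hD]; ring

/-! ## The tail enstrophy-time ceiling -/

/-- **THE TAIL ENSTROPHY-TIME CEILING.** Along every maximal smooth solution Leray–Hopf from `u 0` (`ν > 0`), for every
`t₀ ∈ [0, T)` and EVERY level `q`: `ν · ∑_{n ≥ 0} 4^{q+n} ∫⁻_{(t₀,T)} ‖Δ̇_{q+n} u‖₂² ≤ 12 C_r² ‖u(0)‖₂²` (`C_r` the
reverse-Bernstein constant of the tree's Littlewood–Paley toolbox): Tonelli, the sub-sum over the levels `≥ q` of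
`F(u(τ)) = ∑_l 4^l ‖Δ̇_l u(τ)‖₂² ≤ 24 C_r² ∑_i ‖∂_i u(τ)‖₂²`, and the energy inequality with the classical gradient
`ν ∫₀ᵀ ∫ |∇u|² ≤ ½ ‖u(0)‖₂²`. With the floor: `κ₁ ν² 2^{-3q/2}/‖u₀‖₂ < Tail_q ≤ 12 C_r² ‖u₀‖₂²/ν`.
[cite: CheskidovShvydkoy2011, §4 Lemma 4.1] -/
theorem tail_enstrophyTime_le {ν T : ℝ} (hν : 0 < ν) (hT : 0 < T)
    {u : ℝ → EuclideanSpace ℝ (Fin 3) → EuclideanSpace ℝ (Fin 3)} {p : ℝ → EuclideanSpace ℝ (Fin 3) → ℝ}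
    (hmax : IsMaximalSmoothSolution ν 0 u p T) (hLH : IsLerayHopfOn T ν 0 (u 0) u)
    {t₀ : ℝ} (ht₀ : t₀ ∈ Ico 0 T) (q : ℕ) :
    ENNReal.ofReal ν * ∑' n : ℕ, (2 : ℝ≥0∞) ^ (2 * (q + n)) * ∫⁻ τ in Ioo t₀ T, blockL2 (u τ) (q + n : ℕ) ^ 2 ≤
      12 * ((lpBounds (Fin 3)).Cr : ℝ≥0∞) ^ 2 * eLpNorm (u 0) 2 volume ^ 2 := by
  set K := lpBounds (Fin 3) with hK
  have hE₀top : eLpNorm (u 0) 2 volume ≠ ∞ := (hLH.memLp 0 ⟨le_rfl, hT.le⟩).eLpNorm_ne_top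
  -- measurability of the block energies on the window
  have hfm : ∀ n : ℕ, AEMeasurable (fun τ => (2 : ℝ≥0∞) ^ (2 * (q + n)) * blockL2 (u τ) (q + n : ℕ) ^ 2)
      (volume.restrict (Ioo t₀ T)) := fun n =>
    (((BlockEnergyContinuity.continuousOn_blockL2_sq hν hT hmax hLH ((q + n : ℕ) : ℤ)).mono
      fun τ hτ => ⟨ht₀.1.trans_lt hτ.1, hτ.2⟩).aemeasurable measurableSet_Ioo).const_mul _
  -- Tonelli and the pointwise bound `∑_n 4^{q+n} a_{q+n}² ≤ F ≤ 24 C_r² ∫ |∇u|²`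
  have h1 : ∑' n : ℕ, (2 : ℝ≥0∞) ^ (2 * (q + n)) * ∫⁻ τ in Ioo t₀ T, blockL2 (u τ) (q + n : ℕ) ^ 2 ≤
      24 * (K.Cr : ℝ≥0∞) ^ 2 * ∫⁻ τ in Ioo 0 T, ∫⁻ x, ENNReal.ofReal (frobeniusNormSq (fderiv ℝ (u τ) x)) := by
    calc ∑' n : ℕ, (2 : ℝ≥0∞) ^ (2 * (q + n)) * ∫⁻ τ in Ioo t₀ T, blockL2 (u τ) (q + n : ℕ) ^ 2
        = ∫⁻ τ in Ioo t₀ T, ∑' n : ℕ, (2 : ℝ≥0∞) ^ (2 * (q + n)) * blockL2 (u τ) (q + n : ℕ) ^ 2 := by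
          rw [lintegral_tsum hfm]
          refine tsum_congr fun n => ?_
          rw [lintegral_const_mul' _ _ (ENNReal.pow_ne_top ENNReal.ofNat_ne_top)]
      _ ≤ ∫⁻ τ in Ioo t₀ T, 24 * (K.Cr : ℝ≥0∞) ^ 2 * ∫⁻ x, ENNReal.ofReal (frobeniusNormSq (fderiv ℝ (u τ) x)) := by
          refine setLIntegral_mono' measurableSet_Ioo fun τ hτ => ?_
          have hw : IsSmoothL2Field (u τ) :=
            isSmoothL2Field_slice_of_maximal hν hT hmax hLH ⟨ht₀.1.trans_lt hτ.1, hτ.2⟩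
          calc ∑' n : ℕ, (2 : ℝ≥0∞) ^ (2 * (q + n)) * blockL2 (u τ) (q + n : ℕ) ^ 2
              = ∑' n : ℕ, ((2 : ℝ≥0∞) ^ (((q + n : ℕ) : ℤ)) * blockL2 (u τ) ((q + n : ℕ) : ℤ)) ^ 2 := by
                refine tsum_congr fun n => ?_
                rw [mul_pow, zpow_natCast, ← pow_mul']
            _ ≤ ∑' l : ℤ, ((2 : ℝ≥0∞) ^ l * blockL2 (u τ) l) ^ 2 :=
                ENNReal.tsum_comp_le_tsum_of_injective (f := fun n : ℕ => ((q + n : ℕ) : ℤ))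
                  (fun a b h => by simpa using h) _
            _ = dyadicF (u τ) := rfl
            _ ≤ 8 * (Fintype.card (Fin 3) * ((K.Cr : ℝ≥0∞) ^ 2 * gradSq (u τ))) := K.dyadicF_le_gradSq hw
            _ = 24 * (K.Cr : ℝ≥0∞) ^ 2 * ∫⁻ x, ENNReal.ofReal (frobeniusNormSq (fderiv ℝ (u τ) x)) := by
                rw [Fintype.card_fin, ← sum_eLpNorm_fderiv_sq_eq_lintegral hw]
                simp only [gradSq]
                push_cast
                ring
      _ = 24 * (K.Cr : ℝ≥0∞) ^ 2 * ∫⁻ τ in Ioo t₀ T, ∫⁻ x, ENNReal.ofReal (frobeniusNormSq (fderiv ℝ (u τ) x)) :=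
          lintegral_const_mul' _ _ (ENNReal.mul_ne_top (by norm_num) (ENNReal.pow_ne_top ENNReal.coe_ne_top))
      _ ≤ 24 * (K.Cr : ℝ≥0∞) ^ 2 * ∫⁻ τ in Ioo 0 T, ∫⁻ x, ENNReal.ofReal (frobeniusNormSq (fderiv ℝ (u τ) x)) := by
          gcongr ?_ * ?_
          · exact le_rfl
          · exact lintegral_mono_set (Ioo_subset_Ioo ht₀.1 le_rfl)
  -- the energy inequality: `ν D ≤ ‖u 0‖₂²/2`
  obtain ⟨hDtop, hDle⟩ := dissipation_le_energy hν hT hmax hLH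
  set D : ℝ≥0∞ := ∫⁻ τ in Ioo 0 T, ∫⁻ x, ENNReal.ofReal (frobeniusNormSq (fderiv ℝ (u τ) x)) with hD
  have h2 : ENNReal.ofReal ν * D ≤ eLpNorm (u 0) 2 volume ^ 2 / 2 := by
    have h3 : ENNReal.ofReal ν * D = ENNReal.ofReal (ν * D.toReal) := by
      rw [ENNReal.ofReal_mul hν.le, ENNReal.ofReal_toReal hDtop]
    rw [h3]
    calc ENNReal.ofReal (ν * D.toReal) ≤ ENNReal.ofReal ((eLpNorm (u 0) 2 volume).toReal ^ 2 / 2) :=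
          ENNReal.ofReal_le_ofReal hDle
      _ = eLpNorm (u 0) 2 volume ^ 2 / 2 := by
          rw [ENNReal.ofReal_div_of_pos two_pos, ENNReal.ofReal_pow ENNReal.toReal_nonneg,
            ENNReal.ofReal_toReal hE₀top, ENNReal.ofReal_ofNat]
  calc ENNReal.ofReal ν * ∑' n : ℕ, (2 : ℝ≥0∞) ^ (2 * (q + n)) * ∫⁻ τ in Ioo t₀ T, blockL2 (u τ) (q + n : ℕ) ^ 2
      ≤ ENNReal.ofReal ν * (24 * (K.Cr : ℝ≥0∞) ^ 2 * D) := by gcongr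
    _ = 24 * (K.Cr : ℝ≥0∞) ^ 2 * (ENNReal.ofReal ν * D) := by ring
    _ ≤ 24 * (K.Cr : ℝ≥0∞) ^ 2 * (eLpNorm (u 0) 2 volume ^ 2 / 2) := by gcongr
    _ = 12 * (K.Cr : ℝ≥0∞) ^ 2 * eLpNorm (u 0) 2 volume ^ 2 := by
        rw [div_eq_mul_inv, show (24 : ℝ≥0∞) = 12 * 2 by norm_num]
        calc 12 * 2 * (K.Cr : ℝ≥0∞) ^ 2 * (eLpNorm (u 0) 2 volume ^ 2 * 2⁻¹)
            = 12 * (K.Cr : ℝ≥0∞) ^ 2 * eLpNorm (u 0) 2 volume ^ 2 * (2 * 2⁻¹) := by ring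
          _ = 12 * (K.Cr : ℝ≥0∞) ^ 2 * eLpNorm (u 0) 2 volume ^ 2 := by
              rw [ENNReal.mul_inv_cancel (by norm_num) (by norm_num), mul_one]

/-! ## L18′ — the tail dissipation floor -/

/-- **L18′ — THE TAIL DISSIPATION FLOOR.** There is an absolute `κ₂ > 0` such that for every `ν > 0`, `T > 0`, every maximal
smooth solution `(u, p)` on `ℝ³ × [0, T)` Leray–Hopf from `u 0`, and every `t₀ ∈ [0, T)`: at INFINITELY MANY levels `q`,
`κ₂ ν³ < 2^{3q/2} · ‖u(0)‖₂ · ν ∑_{n ≥ 0} ∫⁻_{(t₀,T)} S_{q+n}(u(τ)) dτ`, `S_p = ∑_i ∫ ‖∂_i Δ̇_p u‖²` the block dissipation —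
the viscous dissipation taking place AT OR BEYOND the scale `2^q` during the terminal window is at least
`κ₂ ν³ 2^{-3q/2}/‖u₀‖₂`, along a subsequence of levels `q → ∞` (tail enstrophy-time floor + reverse Bernstein
`4^p ‖Δ̇_p u‖₂² ≤ 3 C_r² S_p`; the degenerate constant is absorbed by `C_r² + 1`). Against `ν∫₀ᵀ∫|∇u|² ≤ ½‖u₀‖₂²` the
SHARE of the window's dissipation beyond `2^q` is `≥ 2κ₂ (ν/‖u₀‖₂)³ 2^{-3q/2}` infinitely often — a would-be blow-up keeps a
power-law-bounded-below amount of dissipation at arbitrarily fine scales; no finite resolution contains it.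
[cite: CheskidovDai2015, §1 Thm. 1.1] -/
theorem tail_dissipation_floor :
    ∃ κ₂ : ℝ, 0 < κ₂ ∧ ∀ (ν T : ℝ), 0 < ν → 0 < T →
      ∀ (u : ℝ → EuclideanSpace ℝ (Fin 3) → EuclideanSpace ℝ (Fin 3)) (p : ℝ → EuclideanSpace ℝ (Fin 3) → ℝ),
      IsMaximalSmoothSolution ν 0 u p T → IsLerayHopfOn T ν 0 (u 0) u →
      ∀ t₀ ∈ Ico 0 T, ∃ᶠ q : ℕ in atTop,
        ENNReal.ofReal (κ₂ * ν ^ 3) <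
          (2 : ℝ≥0∞) ^ ((q : ℝ) * (3 / 2)) * eLpNorm (u 0) 2 volume *
            (ENNReal.ofReal ν * ∑' n : ℕ, ∫⁻ τ in Ioo t₀ T, ENNReal.ofReal (∑ i, ∫ x,
              ‖fderiv ℝ (blockFn ((q + n : ℕ) : ℤ) (u τ)) x (stdOrthonormalBasis ℝ (EuclideanSpace ℝ (Fin 3)) i)‖ ^ 2)) := by
  obtain ⟨κ₁, hκ₁, H⟩ := tail_enstrophyTime_floor
  set K := lpBounds (Fin 3) with hK
  set cr : ℝ := (K.Cr : ℝ) with hcr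
  set κ₂ : ℝ := κ₁ / (3 * (cr ^ 2 + 1)) with hκ₂
  have hκ₂pos : 0 < κ₂ := by positivity
  refine ⟨κ₂, hκ₂pos, fun ν T hν hT u p hmax hLH t₀ ht₀ => ?_⟩
  -- the constant `D' = 3 (C_r² + 1)` in `ℝ≥0∞`
  set D' : ℝ≥0∞ := 3 * ((K.Cr : ℝ≥0∞) ^ 2 + 1) with hD'
  have hD'0 : D' ≠ 0 := mul_ne_zero (by norm_num) (by simp)
  have hD'top : D' ≠ ∞ := ENNReal.mul_ne_top (by norm_num)
    (ENNReal.add_ne_top.2 ⟨ENNReal.pow_ne_top ENNReal.coe_ne_top, ENNReal.one_ne_top⟩)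
  have hD'real : D' = ENNReal.ofReal (3 * (cr ^ 2 + 1)) := by
    rw [hD', ENNReal.ofReal_mul (by norm_num), ENNReal.ofReal_ofNat, ENNReal.ofReal_add (by positivity) zero_le_one,
      ENNReal.ofReal_pow (NNReal.coe_nonneg _), ENNReal.ofReal_coe_nnreal, ENNReal.ofReal_one]
  have hν0 : ENNReal.ofReal ν ≠ 0 := by rw [Ne, ENNReal.ofReal_eq_zero, not_le]; exact hν
  have hkey : ENNReal.ofReal (κ₂ * ν ^ 3) * D' = ENNReal.ofReal (κ₁ * ν ^ 2) * ENNReal.ofReal ν := by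
    rw [hD'real, ← ENNReal.ofReal_mul (by positivity), ← ENNReal.ofReal_mul (by positivity)]
    congr 1
    rw [hκ₂]
    field_simp
  refine (H ν T hν hT u p hmax hLH t₀ ht₀).mono fun q hq => ?_
  -- pointwise: `4^p a_p² ≤ 3 (C_r² + 1) ofReal(S_p)`
  have hpt : ∀ τ ∈ Ioo t₀ T, ∀ n : ℕ, (2 : ℝ≥0∞) ^ (2 * (q + n)) * blockL2 (u τ) (q + n : ℕ) ^ 2 ≤
      D' * ENNReal.ofReal (∑ i, ∫ x,
        ‖fderiv ℝ (blockFn ((q + n : ℕ) : ℤ) (u τ)) x (stdOrthonormalBasis ℝ (EuclideanSpace ℝ (Fin 3)) i)‖ ^ 2) := by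
    intro τ hτ n
    have hw : IsSmoothL2Field (u τ) := isSmoothL2Field_slice_of_maximal hν hT hmax hLH ⟨ht₀.1.trans_lt hτ.1, hτ.2⟩
    have h := BlockViscousRent.four_pow_mul_blockL2_sq_le hw ((q + n : ℕ) : ℤ)
    rw [(toReal_blockL2_sq_eq hw _).2] at h
    have hz : (2 : ℝ≥0∞) ^ (2 * (((q + n : ℕ) : ℤ))) = (2 : ℝ≥0∞) ^ (2 * (q + n)) := by
      rw [show (2 : ℤ) * ((q + n : ℕ) : ℤ) = ((2 * (q + n) : ℕ) : ℤ) by push_cast; ring, zpow_natCast]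
    rw [hz] at h
    refine h.trans ?_
    rw [hD']
    gcongr
    exact le_self_add
  set S : ℝ≥0∞ := ∑' n : ℕ, ∫⁻ τ in Ioo t₀ T, ENNReal.ofReal (∑ i, ∫ x,
    ‖fderiv ℝ (blockFn ((q + n : ℕ) : ℤ) (u τ)) x (stdOrthonormalBasis ℝ (EuclideanSpace ℝ (Fin 3)) i)‖ ^ 2) with hS
  have htail : ∑' n : ℕ, (2 : ℝ≥0∞) ^ (2 * (q + n)) * ∫⁻ τ in Ioo t₀ T, blockL2 (u τ) (q + n : ℕ) ^ 2 ≤ D' * S := by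
    rw [hS, ← ENNReal.tsum_mul_left]
    refine ENNReal.tsum_le_tsum fun n => ?_
    rw [← lintegral_const_mul' _ _ (ENNReal.pow_ne_top ENNReal.ofNat_ne_top), ← lintegral_const_mul' _ _ hD'top]
    exact setLIntegral_mono' measurableSet_Ioo fun τ hτ => hpt τ hτ n
  set P : ℝ≥0∞ := (2 : ℝ≥0∞) ^ ((q : ℝ) * (3 / 2)) * eLpNorm (u 0) 2 volume with hP
  have hκD : ENNReal.ofReal (κ₂ * ν ^ 3) = (ENNReal.ofReal (κ₁ * ν ^ 2) * ENNReal.ofReal ν) / D' := by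
    rw [ENNReal.eq_div_iff hD'0 hD'top, mul_comm D']
    exact hkey
  rw [hκD, ENNReal.div_lt_iff (Or.inl hD'0) (Or.inl hD'top)]
  calc ENNReal.ofReal (κ₁ * ν ^ 2) * ENNReal.ofReal ν
      = ENNReal.ofReal ν * ENNReal.ofReal (κ₁ * ν ^ 2) := mul_comm _ _
    _ < ENNReal.ofReal ν *
          (P * ∑' n : ℕ, (2 : ℝ≥0∞) ^ (2 * (q + n)) * ∫⁻ τ in Ioo t₀ T, blockL2 (u τ) (q + n : ℕ) ^ 2) :=
        ENNReal.mul_lt_mul_right hν0 ENNReal.ofReal_ne_top hq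
    _ ≤ ENNReal.ofReal ν * (P * (D' * S)) := by gcongr
    _ = P * (ENNReal.ofReal ν * S) * D' := by ring

end Summit.NavierStokesRegularity.FluidComputer.TailDissipationFloor

end
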